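import Summits.AtomisticToContinuum.Crystallization.Theorems.GappedShellCensusCleanLimitsHaveWindowsInplaneGainDefs

/-!
# `CleanLimitsHaveWindows` (stmt-AtomisticToContinuum-15932), line `Sketch`, stub `stub_inplaneGain`, helper 3:
# heights of the layers and of the bond-preserving competitor

Support file for the certified in-plane gain. The competitor of the stub rescales the layers in-plane by `λ` and
replaces the height increments `Δ_m = z(m+1) - z(m)` by `Δ'_m` with `Δ'_m² = Δ_m² + η`, `η = a²(1 - λ²)/3`, so that
the nearest interlayer bonds keep their length. This file controls the height `S_k = z(n+k) - z(n) = ∑_{l<k} Δ_{n+l}`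
of `k` consecutive increments and its competitor `S'_k`:

* `ig_height_eq_sum`, `ig_height_bounds`: `S_k` as a sum, `k d₁ ≤ S_k ≤ k d₂` from `d₁ ≤ Δ ≤ d₂`;
* `ig_vert_U` (contraction, `η ≥ 0`): `S_k ≤ S'_k` and `S'_k² - S_k² ≤ η k² (s²/(4 d₁ d₂) + η/(4 d₁²))`,
  `s = d₁ + d₂`, from `Δ' - Δ ≤ η/(2Δ)` and the chord bound `1/Δ ≤ (s - Δ)/(d₁ d₂)` on `[d₁, d₂]`;
* `ig_vert_L` (expansion, `Δ'² = Δ² - θ`, `θ ≥ 0`): `S'_k ≤ S_k` and `S_k² - S'_k² ≥ k² θ e₁ / d₂` when `Δ' ≥ e₁ > 0`.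
-/

noncomputable section

namespace Summit.AtomisticToContinuum.Crystallization.Theorems.CleanHull

open Finset

/-! ## Heights as sums of increments -/

/-- `z(n + k) - z(n) = ∑_{l<k} (z(n+l+1) - z(n+l))`. [folklore] -/
theorem ig_height_eq_sum (z : ℤ → ℝ) (n : ℤ) (k : ℕ) :
    z (n + k) - z n = ∑ l ∈ range k, (z (n + l + 1) - z (n + l)) := by
  induction k with
  | zero => simp
  | succ k ih =>
    rw [sum_range_succ, ← ih]
    push_cast
    ring

/-- **Height bounds**: if every increment lies in `[d₁, d₂]` then `k d₁ ≤ z(n+k) - z(n) ≤ k d₂`. [folklore] -/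
theorem ig_height_bounds (z : ℤ → ℝ) {d₁ d₂ : ℝ} (h : ∀ m, d₁ ≤ z (m + 1) - z m ∧ z (m + 1) - z m ≤ d₂)
    (n : ℤ) (k : ℕ) : (k : ℝ) * d₁ ≤ z (n + k) - z n ∧ z (n + k) - z n ≤ (k : ℝ) * d₂ := by
  rw [ig_height_eq_sum]
  constructor
  · have := Finset.sum_le_sum fun l (_ : l ∈ range k) => (h (n + l)).1
    rw [sum_const, card_range, nsmul_eq_mul] at this
    simpa [add_assoc] using this
  · have := Finset.sum_le_sum fun l (_ : l ∈ range k) => (h (n + l)).2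
    rw [sum_const, card_range, nsmul_eq_mul] at this
    simpa [add_assoc] using this

/-- Squared height bounds: with increments in `[d₁, d₂]`, `d₁ ≥ 0`: `(k d₁)² ≤ (z(n+k) - z(n))² ≤ (k d₂)²`.
[folklore] -/
theorem ig_height_sq_bounds (z : ℤ → ℝ) {d₁ d₂ : ℝ} (hd₁ : 0 ≤ d₁)
    (h : ∀ m, d₁ ≤ z (m + 1) - z m ∧ z (m + 1) - z m ≤ d₂) (n : ℤ) (k : ℕ) :
    ((k : ℝ) * d₁) ^ 2 ≤ (z (n + k) - z n) ^ 2 ∧ (z (n + k) - z n) ^ 2 ≤ ((k : ℝ) * d₂) ^ 2 := by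
  obtain ⟨h1, h2⟩ := ig_height_bounds z h n k
  have h0 : 0 ≤ (k : ℝ) * d₁ := by positivity
  exact ⟨pow_le_pow_left₀ h0 h1 2, pow_le_pow_left₀ (h0.trans h1) h2 2⟩

/-! ## One increment -/

/-- **One increment under the contraction**: if `0 < d₁ ≤ Δ ≤ d₂`, `Δ' > 0`, `Δ'² = Δ² + η`, `η ≥ 0`, then
`0 ≤ Δ' - Δ ≤ (η/(2 d₁ d₂)) (d₁ + d₂ - Δ)`. [folklore] -/
theorem ig_incr_U {Δ Δ' η d₁ d₂ : ℝ} (hd₁ : 0 < d₁) (h1 : d₁ ≤ Δ) (h2 : Δ ≤ d₂) (hΔ' : 0 < Δ')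
    (hsq : Δ' ^ 2 = Δ ^ 2 + η) (hη : 0 ≤ η) :
    0 ≤ Δ' - Δ ∧ Δ' - Δ ≤ η / (2 * d₁ * d₂) * (d₁ + d₂ - Δ) := by
  have hΔ : 0 < Δ := lt_of_lt_of_le hd₁ h1
  have hd₂ : 0 < d₂ := lt_of_lt_of_le hΔ h2
  have hle : Δ ≤ Δ' := by nlinarith
  refine ⟨by linarith, ?_⟩
  -- `Δ' - Δ = η/(Δ' + Δ) ≤ η/(2Δ)` and `1/(2Δ) ≤ (d₁ + d₂ - Δ)/(2 d₁ d₂)`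
  have hprod : (Δ' - Δ) * (Δ' + Δ) = η := by nlinarith
  have hstep1 : (Δ' - Δ) * (2 * Δ) ≤ η := by nlinarith
  have hchord : d₁ * d₂ ≤ Δ * (d₁ + d₂ - Δ) := by nlinarith
  rw [div_mul_eq_mul_div, le_div_iff₀ (by positivity)]
  nlinarith [mul_le_mul_of_nonneg_left hchord hη]

/-- **One increment under the expansion**: if `0 < Δ ≤ d₂`, `0 < e₁ ≤ Δ'`, `Δ'² = Δ² - θ`, `θ ≥ 0`, then
`Δ' ≤ Δ` and `θ/(2 d₂) ≤ Δ - Δ'`. [folklore] -/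
theorem ig_incr_L {Δ Δ' θ d₂ e₁ : ℝ} (hΔ : 0 < Δ) (h2 : Δ ≤ d₂) (he₁ : 0 < e₁) (h1 : e₁ ≤ Δ')
    (hsq : Δ' ^ 2 = Δ ^ 2 - θ) (hθ : 0 ≤ θ) :
    Δ' ≤ Δ ∧ θ / (2 * d₂) ≤ Δ - Δ' := by
  have hΔ' : 0 < Δ' := lt_of_lt_of_le he₁ h1
  have hle : Δ' ≤ Δ := by nlinarith
  refine ⟨hle, ?_⟩
  have hprod : (Δ - Δ') * (Δ + Δ') = θ := by nlinarith
  rw [div_le_iff₀ (by linarith)]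
  nlinarith

/-! ## `k` increments -/

/-- **Heights under the contraction.** Increments `Δ_l = z(l+1) - z(l) ∈ [d₁, d₂]` (`d₁ > 0`), competitor
increments `Δ'_l > 0` with `Δ'_l² = Δ_l² + η`, `η ≥ 0`. Then for `S = z(n+k) - z(n)`, `S' = z'(n+k) - z'(n)`:
`S ≤ S'` and `S'² - S² ≤ η k² ((d₁ + d₂)²/(4 d₁ d₂) + η/(4 d₁²))`. [folklore] -/
theorem ig_vert_U (z z' : ℤ → ℝ) {η d₁ d₂ : ℝ} (hd₁ : 0 < d₁) (hη : 0 ≤ η)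
    (hz : ∀ m, d₁ ≤ z (m + 1) - z m ∧ z (m + 1) - z m ≤ d₂) (hz'0 : ∀ m, 0 < z' (m + 1) - z' m)
    (hz' : ∀ m, (z' (m + 1) - z' m) ^ 2 = (z (m + 1) - z m) ^ 2 + η) (n : ℤ) (k : ℕ) :
    z (n + k) - z n ≤ z' (n + k) - z' n ∧
      (z' (n + k) - z' n) ^ 2 - (z (n + k) - z n) ^ 2 ≤
        η * (k : ℝ) ^ 2 * ((d₁ + d₂) ^ 2 / (4 * d₁ * d₂) + η / (4 * d₁ ^ 2)) := by
  have hd₂ : 0 < d₂ := by have := hz 0; linarith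
  set S := z (n + k) - z n with hS
  set S' := z' (n + k) - z' n with hS'
  obtain ⟨hSlo, hShi⟩ := ig_height_bounds z hz n k
  -- termwise bounds summed
  have hdiff : S' - S = ∑ l ∈ range k, ((z' (n + l + 1) - z' (n + l)) - (z (n + l + 1) - z (n + l))) := by
    rw [hS, hS', ig_height_eq_sum, ig_height_eq_sum, ← sum_sub_distrib]
  have hterm : ∀ l ∈ range k, 0 ≤ (z' (n + l + 1) - z' (n + l)) - (z (n + l + 1) - z (n + l)) ∧
      (z' (n + l + 1) - z' (n + l)) - (z (n + l + 1) - z (n + l)) ≤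
        η / (2 * d₁ * d₂) * (d₁ + d₂ - (z (n + l + 1) - z (n + l))) := fun l _ =>
    ig_incr_U hd₁ (hz (n + l)).1 (hz (n + l)).2 (hz'0 (n + l)) (hz' (n + l)) hη
  have hlo : 0 ≤ S' - S := by rw [hdiff]; exact sum_nonneg fun l hl => (hterm l hl).1
  have hhi : S' - S ≤ η / (2 * d₁ * d₂) * ((k : ℝ) * (d₁ + d₂) - S) := by
    have h1 : S' - S ≤ ∑ l ∈ range k, η / (2 * d₁ * d₂) * (d₁ + d₂ - (z (n + l + 1) - z (n + l))) := by
      rw [hdiff]; exact sum_le_sum fun l hl => (hterm l hl).2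
    have h2 : ∑ l ∈ range k, η / (2 * d₁ * d₂) * (d₁ + d₂ - (z (n + l + 1) - z (n + l))) =
        η / (2 * d₁ * d₂) * ((k : ℝ) * (d₁ + d₂) - S) := by
      rw [← mul_sum, sum_sub_distrib, sum_const, card_range, nsmul_eq_mul, hS, ig_height_eq_sum]
    linarith
  refine ⟨by linarith, ?_⟩
  -- `S'² - S² = (S' - S)(2S + (S' - S)) ≤ μ (2S + μ)` with `μ = (η/(2d₁d₂))(k s - S) ≤ η k/(2 d₁)`
  set μ := η / (2 * d₁ * d₂) * ((k : ℝ) * (d₁ + d₂) - S) with hμ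
  have hk0 : (0 : ℝ) ≤ k := Nat.cast_nonneg k
  have hS0 : 0 ≤ S := le_trans (by positivity) hSlo
  have hμ0 : 0 ≤ μ := le_trans hlo hhi
  have hμhi : μ ≤ η * k / (2 * d₁) := by
    rw [hμ, div_mul_eq_mul_div, div_le_div_iff₀ (by positivity) (by positivity)]
    have : (k : ℝ) * (d₁ + d₂) - S ≤ k * d₂ := by linarith
    have h3 := mul_le_mul_of_nonneg_left this hη
    nlinarith
  have hsq : S' ^ 2 - S ^ 2 ≤ μ * (2 * S + μ) := by nlinarith
  have hAMGM : η / (2 * d₁ * d₂) * ((k : ℝ) * (d₁ + d₂) - S) * (2 * S) ≤ η * (k : ℝ) ^ 2 * ((d₁ + d₂) ^ 2 / (4 * d₁ * d₂)) := by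
    have h4 : ((k : ℝ) * (d₁ + d₂) - S) * S ≤ ((k : ℝ) * (d₁ + d₂)) ^ 2 / 4 := by
      nlinarith [sq_nonneg ((k : ℝ) * (d₁ + d₂) - 2 * S)]
    have h5 := mul_le_mul_of_nonneg_left h4 (show 0 ≤ η / (2 * d₁ * d₂) by positivity)
    have e : η * (k : ℝ) ^ 2 * ((d₁ + d₂) ^ 2 / (4 * d₁ * d₂)) = η / (2 * d₁ * d₂) * (((k : ℝ) * (d₁ + d₂)) ^ 2 / 4) * 2 := by
      field_simp
    rw [e]; nlinarith
  have hμsq : μ * μ ≤ η * (k : ℝ) ^ 2 * (η / (4 * d₁ ^ 2)) := by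
    have h6 := mul_le_mul hμhi hμhi hμ0 (by positivity)
    have e : η * k / (2 * d₁) * (η * k / (2 * d₁)) = η * (k : ℝ) ^ 2 * (η / (4 * d₁ ^ 2)) := by field_simp; ring
    linarith
  calc S' ^ 2 - S ^ 2 ≤ μ * (2 * S + μ) := hsq
    _ = η / (2 * d₁ * d₂) * ((k : ℝ) * (d₁ + d₂) - S) * (2 * S) + μ * μ := by rw [hμ]; ring
    _ ≤ η * (k : ℝ) ^ 2 * ((d₁ + d₂) ^ 2 / (4 * d₁ * d₂)) + η * (k : ℝ) ^ 2 * (η / (4 * d₁ ^ 2)) := add_le_add hAMGM hμsq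
    _ = _ := by ring

/-- **Heights under the expansion.** Increments `0 < Δ_l ≤ d₂`, competitor increments `Δ'_l ≥ e₁ > 0` with
`Δ'_l² = Δ_l² - θ`, `θ ≥ 0`. Then `S' ≤ S` and `k² θ e₁ / d₂ ≤ S² - S'²`. [folklore] -/
theorem ig_vert_L (z z' : ℤ → ℝ) {θ d₂ e₁ : ℝ} (he₁ : 0 < e₁) (hθ : 0 ≤ θ)
    (hz : ∀ m, 0 < z (m + 1) - z m ∧ z (m + 1) - z m ≤ d₂) (hz' : ∀ m, e₁ ≤ z' (m + 1) - z' m)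
    (hsq : ∀ m, (z' (m + 1) - z' m) ^ 2 = (z (m + 1) - z m) ^ 2 - θ) (n : ℤ) (k : ℕ) :
    z' (n + k) - z' n ≤ z (n + k) - z n ∧
      (k : ℝ) ^ 2 * (θ * e₁ / d₂) ≤ (z (n + k) - z n) ^ 2 - (z' (n + k) - z' n) ^ 2 := by
  have hd₂ : 0 < d₂ := by have := hz 0; linarith
  set S := z (n + k) - z n with hS
  set S' := z' (n + k) - z' n with hS'
  have hS'lo : (k : ℝ) * e₁ ≤ S' := by
    have := (ig_height_bounds z' (d₂ := d₂) (fun m => ⟨hz' m, ?_⟩) n k).1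
    · exact this
    · exact ((ig_incr_L (hz m).1 (hz m).2 he₁ (hz' m) (hsq m) hθ).1).trans (hz m).2
  have hdiff : S - S' = ∑ l ∈ range k, ((z (n + l + 1) - z (n + l)) - (z' (n + l + 1) - z' (n + l))) := by
    rw [hS, hS', ig_height_eq_sum, ig_height_eq_sum, ← sum_sub_distrib]
  have hterm : ∀ l ∈ range k, θ / (2 * d₂) ≤ (z (n + l + 1) - z (n + l)) - (z' (n + l + 1) - z' (n + l)) :=
    fun l _ => (ig_incr_L (hz (n + l)).1 (hz (n + l)).2 he₁ (hz' (n + l)) (hsq (n + l)) hθ).2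
  have hlo : (k : ℝ) * (θ / (2 * d₂)) ≤ S - S' := by
    have := sum_le_sum hterm
    rw [sum_const, card_range, nsmul_eq_mul] at this
    rw [hdiff]; exact this
  have hk0 : (0 : ℝ) ≤ k := Nat.cast_nonneg k
  have h0 : 0 ≤ (k : ℝ) * (θ / (2 * d₂)) := by positivity
  refine ⟨by linarith, ?_⟩
  have hsum : 2 * ((k : ℝ) * e₁) ≤ S + S' := by linarith
  have hke : 0 ≤ (k : ℝ) * e₁ := by positivity
  calc (k : ℝ) ^ 2 * (θ * e₁ / d₂) = ((k : ℝ) * (θ / (2 * d₂))) * (2 * ((k : ℝ) * e₁)) := by field_simp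
    _ ≤ (S - S') * (S + S') := mul_le_mul hlo hsum (by positivity) (le_trans h0 hlo)
    _ = S ^ 2 - S' ^ 2 := by ring

end Summit.AtomisticToContinuum.Crystallization.Theorems.CleanHull

end
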